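import Literature.AlgebraicGeometry.Frobenioids.LiftedSplitting
import Literature.AlgebraicGeometry.Frobenioids.PullbackLinear
import HarnessLib

/-!
# Frobenioids I, proof of Proposition 2.5 (iii), step 1b: the maps `β = β₀ · β₁ ↦ β₀ · β₁^d` on `O^▷(A)`

Mochizuki, *The geometry of Frobenioids I: the general theory*, Kyushu J. Math. **62** (2008)
293–400, §2, proof of Proposition 2.5 (iii), kurims text pp. 49–50
[cite: MochizukiFrdI2008, Prop. 2.5(iii) p.49].

Standing data: a Frobenioid `F : C → F_Φ` of metrically trivial and `Aut`-ample type, a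
characteristic splitting `τ` on `C` (Def. 2.3) and an endomorphism `δ : Φ → Φ` of the monoid `Φ`
("multiplication by `d ∈ Λ_{>0}`", Def. 2.4 (iii); `δ` is arbitrary here, injectivity of `δ` is a
hypothesis where the text uses that `Λ` supports `Φ`).

The text (p. 49–50): "Now we set `Ψ(β) := β₀ · β₁^d` … [where we note that the expression `β₁^d`
makes sense for `d ∈ Λ_{>0}`, by assertion (i); Definition 2.4, (ii)]."  Over the splitting
`O^▷(A) = O^×(A) · τ'(A)` of `LiftedSplitting.lean` this file constructs, for EVERY object `A`:
* `tauPow`: `β₁ ↦ β₁^d`, the element of `τ'(A)` with divisor `δ(Div β₁)`;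
* `unitLinearPow`: `Ψ_A : O^▷(A) → O^▷(A)`, `β₀ · β₁ ↦ β₀ · β₁^d`, a monoid homomorphism
  (`unitLinearPowHom`) which is the identity on `O^×(A)`, multiplies divisors by `δ`
  (`div_unitLinearPow`), is natural with respect to `O^▷(φ)` for linear `φ` out of an isotropic
  object ("functoriality of `τ`", `unitLinearPow_natural`), commutes with `O^▷(A) ↪ O^▷(A^istr)`
  (`hullMap_unitLinearPow`), is injective when `δ` is (`unitLinearPow_injective`) and hits every
  element with divisor in `d · Φ(A)` (`exists_unitLinearPow_eq`).
Composition is diagrammatic; `O^▷(A) ⊆ End A` multiplies by `f * g = g ≫ f`.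
-/

noncomputable section

namespace Literature.AlgebraicGeometry.Frobenioids

open CategoryTheory Opposite

universe w v v' u u'

namespace PreFrobenioid

variable {D : Type u} [Category.{v} D] {Φ : Dᵒᵖ ⥤ CommMonCat.{w}}
  {C : Type u'} [Category.{v'} C] {F : C ⥤ ElemFrobenioid Φ}

namespace CharacteristicSplitting

variable (hF : IsFrobenioid F) (τ : CharacteristicSplitting F)

/-! ### `β₁ ↦ β₁^d` and `Ψ_A : β₀ · β₁ ↦ β₀ · β₁^d` -/

section Pow

variable (hmt : IsOfType (IsMetricallyTrivial F)) (haa : IsOfType (IsAutAmple F)) (δ : Φ ⟶ Φ)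

/-- `β₁ ↦ β₁^d`: the element of `τ'(A)` with divisor `δ(Div β₁)` ("the expression `β₁^d` makes sense
for `d ∈ Λ_{>0}`, by assertion (i)"). [cite: MochizukiFrdI2008, Prop. 2.5(iii) p.50] -/
def tauPow (A : C) (t : endSubmonoid F A) : endSubmonoid F A :=
  (exists_liftedTau_div_eq hF τ (hmt A) (haa A) ((δ.app (op (baseObj F A))).hom (divHom F A t))).choose

/-- `β₁^d ∈ τ'(A)`. [cite: MochizukiFrdI2008, Prop. 2.5(iii) p.50] -/
theorem tauPow_mem (A : C) (t : endSubmonoid F A) : tauPow hF τ hmt haa δ A t ∈ liftedTau hF τ A :=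
  (exists_liftedTau_div_eq hF τ (hmt A) (haa A)
    ((δ.app (op (baseObj F A))).hom (divHom F A t))).choose_spec.1

/-- `Div(β₁^d) = d · Div(β₁)`. [cite: MochizukiFrdI2008, Prop. 2.5(iii) p.50] -/
theorem div_tauPow (A : C) (t : endSubmonoid F A) :
    divHom F A (tauPow hF τ hmt haa δ A t) = (δ.app (op (baseObj F A))).hom (divHom F A t) :=
  (exists_liftedTau_div_eq hF τ (hmt A) (haa A)
    ((δ.app (op (baseObj F A))).hom (divHom F A t))).choose_spec.2

/-- Characterisation of `β₁^d`: the unique element of `τ'(A)` with divisor `d · Div(β₁)`.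
[cite: MochizukiFrdI2008, Prop. 2.5(iii) p.50] -/
theorem tauPow_eq {A : C} {t t' : endSubmonoid F A} (ht' : t' ∈ liftedTau hF τ A)
    (h : divHom F A t' = (δ.app (op (baseObj F A))).hom (divHom F A t)) :
    tauPow hF τ hmt haa δ A t = t' :=
  liftedTau_eq_of_div_eq hF τ (tauPow_mem hF τ hmt haa δ A t) ht'
    ((div_tauPow hF τ hmt haa δ A t).trans h.symm)

/-- `(β₁ β₁')^d = β₁^d β₁'^d` (for any `β₁, β₁' ∈ O^▷(A)`: `β₁^d` only depends on `Div β₁`).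
[cite: MochizukiFrdI2008, Prop. 2.5(iii) p.50] -/
theorem tauPow_mul {A : C} (t t' : endSubmonoid F A) :
    tauPow hF τ hmt haa δ A (t * t') = tauPow hF τ hmt haa δ A t * tauPow hF τ hmt haa δ A t' := by
  apply tauPow_eq hF τ hmt haa δ (mul_mem (tauPow_mem hF τ hmt haa δ A t) (tauPow_mem hF τ hmt haa δ A t'))
  rw [map_mul, map_mul, map_mul, div_tauPow, div_tauPow]

/-- **`Ψ_A(β) := β₀ · β₁^d`** for `β = β₀ · β₁`, `β₀ ∈ O^×(A)`, `β₁ ∈ τ'(A)` (the splitting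
`exists_liftedTau_split`). [cite: MochizukiFrdI2008, Prop. 2.5(iii) p.49] -/
def unitLinearPow (A : C) (β : endSubmonoid F A) : endSubmonoid F A :=
  (exists_liftedTau_split hF τ β).choose_spec.2.choose *
    tauPow hF τ hmt haa δ A (exists_liftedTau_split hF τ β).choose

/-- `Ψ_A` is well defined: for ANY splitting `β = u · t` (`u` a unit, `t ∈ τ'(A)`),
`Ψ_A(β) = u · t^d` (the `τ'`-component is determined by its divisor, the unit by cancellation).
[cite: MochizukiFrdI2008, Prop. 2.5(iii) p.49] -/
theorem unitLinearPow_eq {A : C} {β u t : endSubmonoid F A} (hu : IsUnit u)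
    (ht : t ∈ liftedTau hF τ A) (hβ : β = u * t) :
    unitLinearPow hF τ hmt haa δ A β = u * tauPow hF τ hmt haa δ A t := by
  have hP := hF.isPreFrobenioid
  obtain ⟨ht₀, u₀, hu₀, hβ₀⟩ := (exists_liftedTau_split hF τ β).choose_spec
  -- abbreviate the chosen splitting
  set t₀ := (exists_liftedTau_split hF τ β).choose
  have hu₀' : IsUnit (exists_liftedTau_split hF τ β).choose_spec.2.choose :=
    (exists_liftedTau_split hF τ β).choose_spec.2.choose_spec.1
  have hβ₀' : β = (exists_liftedTau_split hF τ β).choose_spec.2.choose * t₀ :=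
    (exists_liftedTau_split hF τ β).choose_spec.2.choose_spec.2
  set u₁ := (exists_liftedTau_split hF τ β).choose_spec.2.choose
  have htt : t₀ = t := by
    apply liftedTau_eq_of_div_eq hF τ ht₀ ht
    have h1 : divHom F A β = divHom F A t₀ := by
      rw [hβ₀', map_mul, divHom_eq_one_of_isUnit F hP hu₀', one_mul]
    have h2 : divHom F A β = divHom F A t := by
      rw [hβ, map_mul, divHom_eq_one_of_isUnit F hP hu, one_mul]
    rw [← h1, h2]
  have huu : u₁ = u := by
    apply endSubmonoid_mul_right_cancel hF (t := t)
    rw [← hβ, ← htt, ← hβ₀']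
  show u₁ * tauPow hF τ hmt haa δ A t₀ = u * tauPow hF τ hmt haa δ A t
  rw [htt, huu]

/-- `Ψ_A` is multiplicative (`O^▷(A)` is commutative, Remark 1.3.1, and `(β₁β₁')^d = β₁^d β₁'^d`).
[cite: MochizukiFrdI2008, Prop. 2.5(iii) p.49] -/
theorem unitLinearPow_mul {A : C} (β β' : endSubmonoid F A) :
    unitLinearPow hF τ hmt haa δ A (β * β') =
      unitLinearPow hF τ hmt haa δ A β * unitLinearPow hF τ hmt haa δ A β' := by
  obtain ⟨t, ht, u, hu, hβ⟩ := exists_liftedTau_split hF τ β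
  obtain ⟨t', ht', u', hu', hβ'⟩ := exists_liftedTau_split hF τ β'
  have hsplit : β * β' = (u * u') * (t * t') := by
    rw [hβ, hβ', mul_assoc, mul_assoc, ← mul_assoc t, endSubmonoid_comm F hF t u', mul_assoc]
  rw [unitLinearPow_eq hF τ hmt haa δ (hu.mul hu') (mul_mem ht ht') hsplit,
    unitLinearPow_eq hF τ hmt haa δ hu ht hβ, unitLinearPow_eq hF τ hmt haa δ hu' ht' hβ',
    tauPow_mul hF τ hmt haa δ t t', mul_assoc, mul_assoc, ← mul_assoc u',
    endSubmonoid_comm F hF u' (tauPow hF τ hmt haa δ A t), mul_assoc]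

/-- `Ψ_A(1) = 1`. [cite: MochizukiFrdI2008, Prop. 2.5(iii) p.49] -/
theorem unitLinearPow_one (A : C) : unitLinearPow hF τ hmt haa δ A 1 = 1 := by
  rw [unitLinearPow_eq hF τ hmt haa δ isUnit_one (one_mem _) (mul_one 1).symm, one_mul]
  exact tauPow_eq hF τ hmt haa δ (one_mem _) (by simp only [map_one])

/-- **`Ψ_A : O^▷(A) → O^▷(A)`** as a monoid homomorphism. [cite: MochizukiFrdI2008, Prop. 2.5(iii) p.49] -/
def unitLinearPowHom (A : C) : endSubmonoid F A →* endSubmonoid F A where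
  toFun := unitLinearPow hF τ hmt haa δ A
  map_one' := unitLinearPow_one hF τ hmt haa δ A
  map_mul' := unitLinearPow_mul hF τ hmt haa δ

/-- `unitLinearPowHom` is `Ψ_A`. [cite: MochizukiFrdI2008, Prop. 2.5(iii) p.49] -/
@[simp] theorem unitLinearPowHom_apply (A : C) (β : endSubmonoid F A) :
    unitLinearPowHom hF τ hmt haa δ A β = unitLinearPow hF τ hmt haa δ A β := rfl

/-- `Ψ_A(β^n) = Ψ_A(β)^n`. [cite: MochizukiFrdI2008, Prop. 2.5(iii) p.50] -/
theorem unitLinearPow_pow {A : C} (β : endSubmonoid F A) (n : ℕ) :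
    unitLinearPow hF τ hmt haa δ A (β ^ n) = unitLinearPow hF τ hmt haa δ A β ^ n :=
  map_pow (unitLinearPowHom hF τ hmt haa δ A) β n

/-- `Ψ_A` is the identity on `O^×(A)` (`β₁ = 1`). [cite: MochizukiFrdI2008, Prop. 2.5(iii) p.49] -/
theorem unitLinearPow_of_isUnit {A : C} {u : endSubmonoid F A} (hu : IsUnit u) :
    unitLinearPow hF τ hmt haa δ A u = u := by
  rw [unitLinearPow_eq hF τ hmt haa δ hu (one_mem _) (mul_one u).symm,
    tauPow_eq hF τ hmt haa δ (one_mem _) (by simp only [map_one]), mul_one]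

/-- `Ψ_A` on `τ'(A)` is `β₁ ↦ β₁^d`. [cite: MochizukiFrdI2008, Prop. 2.5(iii) p.49] -/
theorem unitLinearPow_of_mem {A : C} {t : endSubmonoid F A} (ht : t ∈ liftedTau hF τ A) :
    unitLinearPow hF τ hmt haa δ A t = tauPow hF τ hmt haa δ A t := by
  rw [unitLinearPow_eq hF τ hmt haa δ isUnit_one ht (one_mul t).symm, one_mul]

/-- **`Div(Ψ_A(β)) = d · Div(β)`**. [cite: MochizukiFrdI2008, Prop. 2.5(iii) p.49] -/
theorem div_unitLinearPow {A : C} (β : endSubmonoid F A) :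
    divHom F A (unitLinearPow hF τ hmt haa δ A β) = (δ.app (op (baseObj F A))).hom (divHom F A β) := by
  have hP := hF.isPreFrobenioid
  obtain ⟨t, ht, u, hu, hβ⟩ := exists_liftedTau_split hF τ β
  rw [unitLinearPow_eq hF τ hmt haa δ hu ht hβ, hβ, map_mul, map_mul,
    divHom_eq_one_of_isUnit F hP hu, one_mul, one_mul, div_tauPow]

/-- `Ψ_A(β)` has divisor in `d · Φ(A)`, i.e. `Ψ_A(β)` is an arrow of `C(d)`.
[cite: MochizukiFrdI2008, Prop. 2.5(iii) p.49] -/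
theorem div_unitLinearPow_mem {A : C} (β : endSubmonoid F A) :
    divHom F A (unitLinearPow hF τ hmt haa δ A β) ∈ imageSubmonoid δ (op (baseObj F A)) :=
  ⟨divHom F A β, (div_unitLinearPow hF τ hmt haa δ β).symm⟩

/-- **`Ψ_A` is injective** when `δ` is injective on `Φ(A)` (`Λ` supports `Φ`): the `τ'`-components
have the same divisor. [cite: MochizukiFrdI2008, Prop. 2.5(iii) p.50] -/
theorem unitLinearPow_injective {A : C} (hδ : Function.Injective (δ.app (op (baseObj F A))).hom) :
    Function.Injective (unitLinearPow hF τ hmt haa δ A) := by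
  have hP := hF.isPreFrobenioid
  intro β β' h
  obtain ⟨t, ht, u, hu, hβ⟩ := exists_liftedTau_split hF τ β
  obtain ⟨t', ht', u', hu', hβ'⟩ := exists_liftedTau_split hF τ β'
  rw [unitLinearPow_eq hF τ hmt haa δ hu ht hβ, unitLinearPow_eq hF τ hmt haa δ hu' ht' hβ'] at h
  have hdiv : divHom F A t = divHom F A t' := by
    apply hδ
    have h1 := congrArg (divHom F A) h
    rwa [map_mul, map_mul, divHom_eq_one_of_isUnit F hP hu, divHom_eq_one_of_isUnit F hP hu',
      one_mul, one_mul, div_tauPow, div_tauPow] at h1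
  have htt : t = t' := liftedTau_eq_of_div_eq hF τ ht ht' hdiv
  subst htt
  have huu : u = u' := endSubmonoid_mul_right_cancel hF h
  rw [hβ, hβ', huu]

/-- **`Ψ_A` hits every `β ∈ O^▷(A)` with `Div(β) ∈ d · Φ(A)`** (used for the fullness of `Ψ`):
`β = β₀ · β₁` with `Div β₁ = d · x`; take `β' := β₀ · s` with `s ∈ τ'(A)`, `Div(s) = x`.
[cite: MochizukiFrdI2008, Prop. 2.5(iii) p.50] -/
theorem exists_unitLinearPow_eq {A : C} {β : endSubmonoid F A}
    (hβ : divHom F A β ∈ imageSubmonoid δ (op (baseObj F A))) :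
    ∃ β' : endSubmonoid F A, unitLinearPow hF τ hmt haa δ A β' = β := by
  have hP := hF.isPreFrobenioid
  obtain ⟨x, hx⟩ := hβ
  obtain ⟨t, ht, u, hu, hβt⟩ := exists_liftedTau_split hF τ β
  obtain ⟨s, hs, hsx⟩ := exists_liftedTau_div_eq hF τ (hmt A) (haa A) x
  refine ⟨u * s, ?_⟩
  rw [unitLinearPow_eq hF τ hmt haa δ hu hs rfl, hβt]
  congr 1
  apply tauPow_eq hF τ hmt haa δ ht
  rw [hsx, hx, hβt, map_mul, divHom_eq_one_of_isUnit F hP hu, one_mul]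

/-! ### Naturality of `Ψ` ("functoriality of the characteristic splitting `τ(−)`") -/

/-- **Naturality of `Ψ`** with respect to `O^▷(φ)` for a linear `φ : X → Y` out of an isotropic
object: if `φ ; β = β' ; φ` then `φ ; Ψ_Y(β) = Ψ_X(β') ; φ` ("the functoriality of `τ` with respect
to morphisms of `(C^istr)^lin`", p. 50; units go to units and `Div ∘ O^▷(φ) = φ^* ∘ Div`).
[cite: MochizukiFrdI2008, Prop. 2.5(iii) p.50] -/
theorem unitLinearPow_natural {X Y : C} (hX : IsIsotropic F X) {φ : X ⟶ Y} (hφ : IsLinear F φ)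
    {β : endSubmonoid F Y} {β' : endSubmonoid F X}
    (h : φ ≫ (β.1 : Y ⟶ Y) = (β'.1 : X ⟶ X) ≫ φ) :
    φ ≫ ((unitLinearPow hF τ hmt haa δ Y β).1 : Y ⟶ Y) =
      ((unitLinearPow hF τ hmt haa δ X β').1 : X ⟶ X) ≫ φ := by
  have hco : IsCoAngular F φ := isCoAngular_of_isIsotropic_codomains F φ fun _ g => hF.vii_b g hX
  obtain ⟨t, ht, u, hu, hβ⟩ := exists_liftedTau_split hF τ β
  -- intertwiners along `φ` of `u`, `u⁻¹`, `t`, `t^d`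
  obtain ⟨v, hv⟩ := hu
  obtain ⟨u', hu'⟩ := exists_endSubmonoid_intertwiner hF hco hφ (v : endSubmonoid F Y)
  obtain ⟨w', hw'⟩ := exists_endSubmonoid_intertwiner hF hco hφ ((v⁻¹ : (endSubmonoid F Y)ˣ) : endSubmonoid F Y)
  obtain ⟨t', ht'⟩ := exists_endSubmonoid_intertwiner hF hco hφ t
  obtain ⟨s', hs'⟩ := exists_endSubmonoid_intertwiner hF hco hφ (tauPow hF τ hmt haa δ Y t)
  -- products are intertwined with products
  have hmul : ∀ {a b : endSubmonoid F Y} {a' b' : endSubmonoid F X},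
      φ ≫ (a.1 : Y ⟶ Y) = (a'.1 : X ⟶ X) ≫ φ → φ ≫ (b.1 : Y ⟶ Y) = (b'.1 : X ⟶ X) ≫ φ →
        φ ≫ ((a * b).1 : Y ⟶ Y) = ((a' * b').1 : X ⟶ X) ≫ φ := by
    intro a b a' b' ha hb
    rw [Submonoid.coe_mul, Submonoid.coe_mul, End.mul_def, End.mul_def, ← Category.assoc, hb,
      Category.assoc, ha, Category.assoc]
  -- `u'` is a unit
  have hu'unit : IsUnit u' := by
    have h1 : φ ≫ ((↑v * ↑v⁻¹ : endSubmonoid F Y).1 : Y ⟶ Y) = ((u' * w').1 : X ⟶ X) ≫ φ :=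
      hmul hu' hw'
    have h2 : φ ≫ ((↑v⁻¹ * ↑v : endSubmonoid F Y).1 : Y ⟶ Y) = ((w' * u').1 : X ⟶ X) ≫ φ :=
      hmul hw' hu'
    rw [Units.mul_inv] at h1
    rw [Units.inv_mul] at h2
    have e1 : u' * w' = 1 := endSubmonoid_intertwiner_unique hF hφ h1
      (by rw [OneMemClass.coe_one, OneMemClass.coe_one, End.one_def, End.one_def,
        Category.id_comp, Category.comp_id])
    have e2 : w' * u' = 1 := endSubmonoid_intertwiner_unique hF hφ h2
      (by rw [OneMemClass.coe_one, OneMemClass.coe_one, End.one_def, End.one_def,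
        Category.id_comp, Category.comp_id])
    exact ⟨⟨u', w', e1, e2⟩, rfl⟩
  -- `t' ∈ τ'(X)` and `s' = t'^d`
  have ht'mem : t' ∈ liftedTau hF τ X := mem_liftedTau_of_intertwine hF τ hφ ht ht'
  have hs'mem : s' ∈ liftedTau hF τ X :=
    mem_liftedTau_of_intertwine hF τ hφ (tauPow_mem hF τ hmt haa δ Y t) hs'
  have hs'eq : tauPow hF τ hmt haa δ X t' = s' := by
    apply tauPow_eq hF τ hmt haa δ hs'mem
    rw [div_eq_pull_div_of_intertwine hF hφ hs', div_eq_pull_div_of_intertwine hF hφ ht',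
      div_tauPow, end_app_pull]
  -- `β' = u' t'`
  have hβ' : β' = u' * t' :=
    endSubmonoid_intertwiner_unique hF hφ h (by rw [hβ, ← hv]; exact hmul hu' ht')
  rw [unitLinearPow_eq hF τ hmt haa δ ⟨v, hv⟩ ht hβ, unitLinearPow_eq hF τ hmt haa δ hu'unit ht'mem hβ',
    hs'eq, ← hv]
  exact hmul hu' hs'

/-! ### Compatibility with the isotropic hull -/

/-- **`Ψ` commutes with `O^▷(A) ↪ O^▷(A^istr)`** (Prop. 2.2 (iv), chosen hull):
`O^▷(h)(Ψ_A(β)) = Ψ_{A^istr}(O^▷(h)(β))`. [cite: MochizukiFrdI2008, Prop. 2.5(iii) p.49] -/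
theorem hullMap_unitLinearPow {A : C} (β : endSubmonoid F A) :
    hullMap (isIsotropicHull_hullHom hF A) (unitLinearPow hF τ hmt haa δ A β) =
      unitLinearPow hF τ hmt haa δ (hullObj hF A) (hullMap (isIsotropicHull_hullHom hF A) β) := by
  have hh := isIsotropicHull_hullHom hF A
  have hY : IsIsotropic F (hullObj hF A) := hh.2.2.1
  haveI : IsIso (Base F (hullHom hF A)) := hh.2.1.2
  obtain ⟨t, ht, u, hu, hβ⟩ := exists_liftedTau_split hF τ β
  have htY : hullMap hh t ∈ liftedTau hF τ (hullObj hF A) :=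
    (mem_liftedTau_iff_of_isIsotropic hF τ hY _).mpr ht
  have hpow : tauPow hF τ hmt haa δ (hullObj hF A) (hullMap hh t) =
      hullMap hh (tauPow hF τ hmt haa δ A t) := by
    apply tauPow_eq hF τ hmt haa δ
      ((mem_liftedTau_iff_of_isIsotropic hF τ hY _).mpr (tauPow_mem hF τ hmt haa δ A t))
    apply pull_injective_of_isIso Φ (Base F (hullHom hF A))
    rw [pull_div_hullMap hF hh, div_tauPow, ← end_app_pull, pull_div_hullMap hF hh]
  rw [unitLinearPow_eq hF τ hmt haa δ hu ht hβ, map_mul,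
    unitLinearPow_eq hF τ hmt haa δ (hu.map _) htY (by rw [hβ, map_mul]), hpow]

end Pow

end CharacteristicSplitting

end PreFrobenioid

end Literature.AlgebraicGeometry.Frobenioids
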